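import Summits.QuantumAdvantage.AdviceFreeQNC0.CleanGapStrategies
import Summits.QuantumAdvantage.AdviceFreeQNC0.WalkTransport
import HarnessLib

/-!
# Cell qa-qnc0 (p = 3 line R0-sparse): a FIXED bell set with an inner bell-free gap wins at most `(2/3)(1 + 2^{-m})`

Planner qa-qnc0-p1 g15, `LINE-R1.md` / `Sketch18.lean` §6, rung **R0-sparse** — in the CORRECTED form
`FixedBellsInnerGap3` (= p1's `FixedBellsGap3` with the extra conjunct `a + m ≤ N`: the gap of `m` consecutive
bell-free cuts must lie inside the cut range; without it the typed statement degenerates at `a = m = N-1` to the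
unproved dense half `FixedBellsSharp3` — see this seat's INBOX note 2026-08-27T19:4xZ).

**Statement.**  For a pattern `x ∈ {0,1}^N` of the odd class and a FIXED set `B` of cuts (the degree-`0` strategy
`z = tGuess x ⊕ 1_B`), if the cuts `a, …, a+m-1` carry no bell and `a + m ≤ N`, then
`3·2^m·#{x odd : Rel x (z x)} ≤ (2^m + 1)·2^N`, i.e. the win rate on the odd class is `≤ (2/3)(1 + 2^{-m})`.

**Proof** (entirely in the u-coordinates of the cell; no `BellForm3`/`BellParity3` dictionary is needed):
by `WalkTransport.rel_iff_ringWinU`, on the odd class `Rel x (z x)` holds iff the transported walk strategy wins at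
`u = uVec x`, and for `z = tGuess ⊕ 1_B` the transported strategy is the CONSTANT selector `y_g(u) = [g ∈ B]` (the two
`tGuess` terms cancel); `uVec` is injective on the odd class (`xOfU_uVec`).  A constant selector that skips the cuts
`a … a+m-1` neither reads nor bets inside the window of the `m` bits `a-1, …, a+m-2` (bits `0 … m-1` if `a = 0`), so
qn-prover g3's GAP LEMMA `CleanGapStrategies.ringWinU_cleanGap_le` (`3·#WIN ≤ 2·2ⁿ + 2·2^{n-m}`, `n = N - 1`:
conditioning on the outside bits, the window weight shifts every left bell by `+T` and every right bell by `+2T`,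
at most two of the three residues of `T` win — ChargeTriple — and each residue class of `{0,1}^m` has
`≤ (2^m + 2)/3` elements) gives the bound with `c = 1`.

WHAT THIS IS NOT: not p1's `FixedBellsGap3` verbatim (misstated, see above) and not the dense half
`FixedBellsSharp3` (open); nothing on adaptive bells (R1 `WindowLocalTwoThirds3` needs a two-sided gap lemma);
separation NOT moved.
-/

noncomputable section

namespace Summit.QuantumAdvantage.AdviceFreeQNC0

open Finset Literature.Computability.QuantumComplexity Literature.Computability.QuantumComplexity.RingHLF
open Literature.Computability.MetaComplexity

/-- **R0-sparse, inner-gap form `FixedBellsInnerGap3`** (qa-qnc0-p1 Sketch18 §6 `FixedBellsGap3` with the conjunct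
`a + m ≤ N` added inside the `∃ a`): a fixed bell set with a bell-free gap of `m` consecutive cuts INSIDE the cut
range wins on at most `(2/3 + c·2^{-m})·2^{N-1}` odd-class inputs. -/
def FixedBellsInnerGap3 : Prop :=
  ∃ c : ℕ, ∀ (N m : ℕ), 3 ≤ N → m + 1 ≤ N → ∀ B : Finset (Fin N),
    (∃ a : ℕ, a + m ≤ N ∧ ∀ k : Fin N, (a ≤ k.val ∧ k.val < a + m) → k ∉ B) →
    3 * 2 ^ m * (univ.filter fun x : Fin N → Bool =>
        (univ.filter fun b : Fin N => x b = false).card % 2 = 1 ∧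
          RingHLF.Rel x (fun k => xor (tGuess x k) (decide (k ∈ B)))).card ≤ (2 ^ m + c) * 2 ^ N

/-- **R0-sparse (inner gap) — PROVED with `c = 1`**: `3·2^m·#{x odd : Rel x (tGuess x ⊕ 1_B)} ≤ (2^m + 1)·2^N`
whenever the cuts `a … a+m-1` (`a + m ≤ N`) carry no bell. -/
theorem fixedBellsInnerGap3 : FixedBellsInnerGap3 := by
  classical
  refine ⟨1, fun N m hN hm B hB => ?_⟩
  -- write `N = p + m + q + 1` with the window of `m` bits starting at bit `p = a - 1`
  obtain ⟨p, q, hpa, rfl⟩ : ∃ p q : ℕ, (∀ g : ℕ, p < g → g < p + m → ∃ a, (a ≤ g ∧ g < a + m) ∧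
      ∀ k : Fin N, (a ≤ k.val ∧ k.val < a + m) → k ∉ B) ∧ N = p + m + q + 1 := by
    obtain ⟨a, ham, hgapB⟩ := hB
    exact ⟨a - 1, N - 1 - (a - 1) - m, fun g h1 h2 => ⟨a, ⟨by omega, by omega⟩, hgapB⟩, by omega⟩
  -- the constant selector in u-coordinates and the gap lemma
  set y : Fin (p + m + q + 1) → (Fin (p + m + q) → Bool) → Bool := fun g _ => decide (g ∈ B) with hy
  have hgap : ∀ g : Fin (p + m + q + 1), p < g.val → g.val < p + m → ∀ w, y g w = false := by
    intro g h1 h2 w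
    obtain ⟨a, hag, hgapB⟩ := hpa g.val h1 h2
    simp only [hy, decide_eq_false_iff_not]
    exact hgapB g hag
  have hloc : ∀ (g : Fin (p + m + q + 1)) (a' : Fin p → Bool) (v v' : Fin m → Bool) (b : Fin q → Bool),
      y g (glue3 a' v b) = y g (glue3 a' v' b) := fun _ _ _ _ _ => rfl
  have hGap := ringWinU_cleanGap_le (p + m + q + 2) y hgap hloc
  -- the odd class injects into the walk wins of `y` (transport along `uVec`)
  set z : (Fin (p + m + q + 1) → Bool) → (Fin (p + m + q + 1) → Bool) :=
    fun x k => xor (tGuess x k) (decide (k ∈ B)) with hz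
  have hy' : (fun (g : Fin (p + m + q + 1)) (u : Fin (p + m + q) → Bool) =>
      xor (z (xOfU u) g) (tGuess (xOfU u) g)) = y := by
    funext g u
    simp only [hz, hy]
    generalize tGuess (xOfU u) g = t
    generalize decide (g ∈ B) = d
    cases t <;> cases d <;> rfl
  have hinj : (univ.filter fun x : Fin (p + m + q + 1) → Bool =>
        (univ.filter fun b : Fin (p + m + q + 1) => x b = false).card % 2 = 1 ∧ Rel x (z x)).card ≤
      (univ.filter fun w : Fin (p + m + q) → Bool => ringWinU (p + m + q + 2) y w = true).card := by
    refine Finset.card_le_card_of_injOn uVec ?_ ?_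
    · intro x hx
      rw [Finset.mem_coe, mem_filter] at hx
      rw [Finset.mem_coe, mem_filter]
      refine ⟨mem_univ _, ?_⟩
      have h := (rel_iff_ringWinU (by omega) x hx.2.1 z).1 hx.2.2
      rwa [hy'] at h
    · intro x₁ hx₁ x₂ hx₂ h
      rw [Finset.mem_coe, mem_filter] at hx₁ hx₂
      rw [← xOfU_uVec (by omega) x₁ hx₁.2.1, ← xOfU_uVec (by omega) x₂ hx₂.2.1, h]
  -- arithmetic: `2^m · (2·2ⁿ + 2·2^{p+q}) = (2^m + 1) · 2^{n+1}`
  have hpow : 2 ^ m * (2 * 2 ^ (p + m + q) + 2 * 2 ^ (p + q)) = (2 ^ m + 1) * 2 ^ (p + m + q + 1) := by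
    ring
  have h3 : 3 * 2 ^ m * (univ.filter fun x : Fin (p + m + q + 1) → Bool =>
          (univ.filter fun b : Fin (p + m + q + 1) => x b = false).card % 2 = 1 ∧ Rel x (z x)).card
      ≤ 2 ^ m * (3 * (univ.filter fun w : Fin (p + m + q) → Bool =>
          ringWinU (p + m + q + 2) y w = true).card) := by
    have := Nat.mul_le_mul_left (3 * 2 ^ m) hinj
    linarith
  calc 3 * 2 ^ m * (univ.filter fun x : Fin (p + m + q + 1) → Bool =>
          (univ.filter fun b : Fin (p + m + q + 1) => x b = false).card % 2 = 1 ∧ Rel x (z x)).card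
      ≤ 2 ^ m * (3 * (univ.filter fun w : Fin (p + m + q) → Bool =>
          ringWinU (p + m + q + 2) y w = true).card) := h3
    _ ≤ 2 ^ m * (2 * 2 ^ (p + m + q) + 2 * 2 ^ (p + q)) := Nat.mul_le_mul_left _ hGap
    _ = (2 ^ m + 1) * 2 ^ (p + m + q + 1) := hpow

end Summit.QuantumAdvantage.AdviceFreeQNC0

end
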